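import Summits.HodgeConjecture.HodgeConjecture.Theorems.F0P3cStCharTSDGField          -- ★ p851395 (this seat) «DG-FIELD★» at `N = 3`: §0 `apply_ne_zero_of_isUnit`, `exists_apply_eq_zero_of_not_isUnit` (units of `Π_w L_w`) and the vocabulary
import HarnessLib

/-!
# F0 · P3c · line LH6 «StCharTS» — «DG-FIELD★» AT `N = 2`: the ∃-FIELD `D_{U(2)}` on `U(J)(L⁺_v)` for any `2 × 2` Hermitian form `J` — the `U(Φ₂)` factor of print's `D_H` on
# `H = U(Φ₂)(L⁺_v) × U(Φ₁)(L⁺_v)` [Rogawski1990, §4.9 pp. 54–55 («`D_H` defined similarly»); §12.5 p. 184] [HarishChandra1999AdmissibleDistributions, §17]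

Cell `pub/hodgecm-mathlib`, crux H413 = `stmt-HodgeConjecture-24833` (lane `--supports … --as helper`), route HCCMUnconditional; seat F0P3-p02 (g20); datum road of the (S-𝔇)
organ `stub_EllipticPackage` (`Cruxes/H413/Lines/F0_P3c_StCharTSPaydown.lean`), map owner LH6-p01 (g4); the `N = 2` TWIN of ★ `F0P3cStCharTSDGField.exists_DG_field` asked by
F0P2-p01 (g21) for (B) «H-FIELDS» (2026-09-02T12:12:11Z: «cut `exists_DG_field` generic in `N` (or add the `N = 2` twin) so `DH := DG₂ ∘ Prod.fst` is ★»).  THEOREMS ONLY (no definition ∕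
instance ∕ notation ∕ named fact ∕ `sorry`); ★-only imports; own file (one topic, the `N = 3` file is at 330 l.).
HONEST LABEL: HC_CM is proved only modulo the 7 printed citations (2 remaining named inputs: hLiu418 = `stmt-HodgeConjecture-24832`, h413 = `stmt-HodgeConjecture-24833`)
until rung 0 closes; this file closes no organ — it pins the `U(Φ₂)` factor of the datum field `DH`, count-neutral.

THE CLOSED FORM AT `N = 2` (spelled inline, no `def`): `N(x) := Π_{w∣v} |x_w|_w` on `R = Π_w L_w` and `dg₂(γ) := √√( N(discr(charpoly γ)) · N(det γ)⁻¹ )` — ONE power of `N(det)`, because the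
Harish-Chandra antecedent at `N = 2` reads `u·det(γ)^(2−1) = discr(charpoly γ)` (`Π_{i≠j}(1 − λᵢλⱼ⁻¹) = −(λ₁ − λ₂)²∕(λ₁λ₂)`, [§4.9 p. 54; HC §17]).
* `continuous_dgFormulaTwo` (★ `continuous_charpoly_coeff`, Mathlib `discr_of_degree_eq_two`, `Continuous.matrix_det`, ★ `continuous_normAbs`), `dgFormulaTwo_eq_of_unit_rel` (`= √√‖u‖` at the
  antecedent, ★ `unitModulusChar_localRing_eq_prod`), `dgFormulaTwo_eq_zero_of_not_isUnit_discr`, `exists_unit_rel_iff_isUnit_discr_two`, and the ∃-head **`exists_DG_field_two`**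
  (`∃ DG₂, Measurable ∧ (¬ IsUnit discr → 0) ∧ (u·det^(2−1) = discr → √√‖u‖)`, the letters of ★ `exists_DG_field` with `3 ↦ 2`).

## References
* [Rogawski1990] J. D. Rogawski, *Automorphic Representations of Unitary Groups in Three Variables*, Ann. of Math. Stud. 123 (1990): §4.9 pp. 54–55 (`D_G`, `D_H`); §12.5 p. 184 (`⟨ , ⟩_{H,e}`).
* [HarishChandra1999AdmissibleDistributions] Harish-Chandra (notes by S. DeBacker, P. J. Sally), *Admissible invariant distributions on reductive p-adic groups*, AMS ULS 16 (1999): §17.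
* [WeilBNT1967] A. Weil, *Basic Number Theory* (1967), Ch. I §2 (modules of finite products).
-/

set_option autoImplicit false
-- the mandated namespace has the single-problem summit's repeated segment (`HodgeConjecture.HodgeConjecture`)
set_option linter.dupNamespace false

noncomputable section

open MeasureTheory Filter Topology Polynomial
open NumberField IsDedekindDomain
open scoped NNReal Matrix MatrixGroups
open Literature.NumberTheory.Automorphic Literature.NumberTheory.Automorphic.UnitaryGroup
open Literature.NumberTheory.GaloisRepresentations Literature.NumberTheory.GaloisRepresentations.IsNonarchimedeanLocalField
open Literature.NumberTheory.Rogawski1990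

namespace Summit.HodgeConjecture.HodgeConjecture.Cruxes.H413.F0P3cStCharTSDGFieldTwo

open Summit.HodgeConjecture.HodgeConjecture.Cruxes.H413.F0P3cStCharTSDGField

variable (L : Type) [Field L] [NumberField L] [IsCMField L] (v : HeightOneSpectrum (𝓞 ↥(maximalRealSubfield L)))

/-! ## §1 THE `N = 2` TWIN — `D_H`'s `U(Φ₂)` factor (ask of F0P2-p01 (g21), (B) «H-FIELDS», 2026-09-02T12:12:11Z): the same letters on `(cmDatum L 2 J).Local v` for ANY `2 × 2` form `J`;
the Harish-Chandra antecedent at `N = 2` is `u·det(γ)^(2−1) = discr(charpoly γ)`, so the closed form is `√√(N(discr(charpoly γ))·N(det γ)⁻¹)` (ONE power of `N(det)`); Mathlib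
`discr_of_degree_eq_two`.  Then `DH := DG₂ ∘ Prod.fst` on `H = U(Φ₂)(L⁺_v) × U(Φ₁)(L⁺_v)` reads a ★ (the `U(1)` factor has no roots). -/

section Two

variable (J : Matrix (Fin 2) (Fin 2) L)

/-- **Continuity of the `N = 2` closed form** `γ ↦ √√(N(discr(charpoly γ))·N(det γ)⁻¹)` on `U(J)(L⁺_v)`, `J` any `2 × 2` form (★ `continuous_charpoly_coeff`, Mathlib `discr_of_degree_eq_two`,
`Continuous.matrix_det`, ★ `continuous_normAbs`; `N(det γ) ≠ 0`). [cite: Rogawski1990, §4.9 pp. 54–55; §12.5 p. 184] -/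
theorem continuous_dgFormulaTwo :
    Continuous fun g : (UnitaryGroup.cmDatum L 2 J).Local v =>
      ((NNReal.sqrt (NNReal.sqrt
        ((∏ w : PlacesOver L v, normAbs (w.1.adicCompletion L) (((g.val : GL (Fin 2) (UnitaryGroup.LocalRing L v)).val.charpoly.discr) w)) *
          (∏ w : PlacesOver L v, normAbs (w.1.adicCompletion L) (((g.val : GL (Fin 2) (UnitaryGroup.LocalRing L v)).val.det) w))⁻¹)) : ℝ≥0) : ℝ) := by
  have hM : Continuous fun g : (UnitaryGroup.cmDatum L 2 J).Local v => ((g.val : GL (Fin 2) (UnitaryGroup.LocalRing L v)).val : Matrix (Fin 2) (Fin 2) (UnitaryGroup.LocalRing L v)) :=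
    Units.continuous_val.comp continuous_subtype_val
  have hc : ∀ i : ℕ, Continuous fun g : (UnitaryGroup.cmDatum L 2 J).Local v => ((g.val : GL (Fin 2) (UnitaryGroup.LocalRing L v)).val.charpoly.coeff i) :=
    fun i => (Literature.LinearAlgebra.Matrix.continuous_charpoly_coeff i).comp hM
  have hdisc : Continuous fun g : (UnitaryGroup.cmDatum L 2 J).Local v => (g.val : GL (Fin 2) (UnitaryGroup.LocalRing L v)).val.charpoly.discr := by
    have heq : (fun g : (UnitaryGroup.cmDatum L 2 J).Local v => (g.val : GL (Fin 2) (UnitaryGroup.LocalRing L v)).val.charpoly.discr) = fun g : (UnitaryGroup.cmDatum L 2 J).Local v =>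
        (g.val : GL (Fin 2) (UnitaryGroup.LocalRing L v)).val.charpoly.coeff 1 ^ 2 - 4 * (g.val : GL (Fin 2) (UnitaryGroup.LocalRing L v)).val.charpoly.coeff 0 * (g.val : GL (Fin 2) (UnitaryGroup.LocalRing L v)).val.charpoly.coeff 2 := by
      funext g
      exact discr_of_degree_eq_two (by rw [Matrix.charpoly_degree_eq_dim]; rfl)
    rw [heq]
    fun_prop
  have hdet : Continuous fun g : (UnitaryGroup.cmDatum L 2 J).Local v => (g.val : GL (Fin 2) (UnitaryGroup.LocalRing L v)).val.det :=
    (continuous_id.matrix_det).comp hM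
  have h1 : Continuous fun g : (UnitaryGroup.cmDatum L 2 J).Local v =>
      ∏ w : PlacesOver L v, normAbs (w.1.adicCompletion L) (((g.val : GL (Fin 2) (UnitaryGroup.LocalRing L v)).val.charpoly.discr) w) :=
    continuous_finsetProd _ fun w _ => LocalFieldHaar.continuous_normAbs.comp ((continuous_apply w).comp hdisc)
  have h2 : Continuous fun g : (UnitaryGroup.cmDatum L 2 J).Local v =>
      ∏ w : PlacesOver L v, normAbs (w.1.adicCompletion L) (((g.val : GL (Fin 2) (UnitaryGroup.LocalRing L v)).val.det) w) :=
    continuous_finsetProd _ fun w _ => LocalFieldHaar.continuous_normAbs.comp ((continuous_apply w).comp hdet)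
  have h2' : ∀ g : (UnitaryGroup.cmDatum L 2 J).Local v, (∏ w : PlacesOver L v, normAbs (w.1.adicCompletion L) (((g.val : GL (Fin 2) (UnitaryGroup.LocalRing L v)).val.det) w)) ≠ 0 :=
    fun g => Finset.prod_ne_zero_iff.2 fun w _ => (_root_.map_ne_zero _).2
      (apply_ne_zero_of_isUnit L v (Matrix.isUnits_det_units (g.val : GL (Fin 2) (UnitaryGroup.LocalRing L v))) w)
  exact NNReal.continuous_coe.comp (NNReal.continuous_sqrt.comp (NNReal.continuous_sqrt.comp (h1.mul (h2.inv₀ h2'))))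

/-- **Value at the `N = 2` Harish-Chandra antecedent**: if `u·det(γ) = discr(charpoly γ)` for a unit `u`, then `N(discr)·N(det)⁻¹ = N(u) = ‖u‖` (★ `unitModulusChar_localRing_eq_prod`), so the
closed form equals `√√‖u‖` — the weight of ★ `normalizedCharacter_locallyBounded` at `N = 2`. [cite: Rogawski1990, §4.9 pp. 54–55] [cite: HarishChandra1999AdmissibleDistributions, §17] -/
theorem dgFormulaTwo_eq_of_unit_rel (g : (UnitaryGroup.cmDatum L 2 J).Local v) (u : (UnitaryGroup.LocalRing L v)ˣ)
    (hu : (u : UnitaryGroup.LocalRing L v) * ((g.val : GL (Fin 2) (UnitaryGroup.LocalRing L v)).val.det) ^ (2 - 1) =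
      ((g.val : GL (Fin 2) (UnitaryGroup.LocalRing L v)).val.charpoly).discr) :
    ((NNReal.sqrt (NNReal.sqrt
        ((∏ w : PlacesOver L v, normAbs (w.1.adicCompletion L) (((g.val : GL (Fin 2) (UnitaryGroup.LocalRing L v)).val.charpoly.discr) w)) *
          (∏ w : PlacesOver L v, normAbs (w.1.adicCompletion L) (((g.val : GL (Fin 2) (UnitaryGroup.LocalRing L v)).val.det) w))⁻¹)) : ℝ≥0) : ℝ) =
      ((NNReal.sqrt (NNReal.sqrt (unitModulusChar (UnitaryGroup.LocalRing L v) u)) : ℝ≥0) : ℝ) := by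
  have hd : (∏ w : PlacesOver L v, normAbs (w.1.adicCompletion L) (((g.val : GL (Fin 2) (UnitaryGroup.LocalRing L v)).val.det) w)) ≠ 0 :=
    Finset.prod_ne_zero_iff.2 fun w _ => (_root_.map_ne_zero _).2
      (apply_ne_zero_of_isUnit L v (Matrix.isUnits_det_units (g.val : GL (Fin 2) (UnitaryGroup.LocalRing L v))) w)
  have hprod : (∏ w : PlacesOver L v, normAbs (w.1.adicCompletion L) (((g.val : GL (Fin 2) (UnitaryGroup.LocalRing L v)).val.charpoly.discr) w)) =
      (∏ w : PlacesOver L v, normAbs (w.1.adicCompletion L) ((u : UnitaryGroup.LocalRing L v) w)) *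
        (∏ w : PlacesOver L v, normAbs (w.1.adicCompletion L) (((g.val : GL (Fin 2) (UnitaryGroup.LocalRing L v)).val.det) w)) := by
    rw [← hu, pow_one, ← Finset.prod_mul_distrib]
    refine Finset.prod_congr rfl fun w _ => ?_
    rw [Pi.mul_apply, map_mul]
  congr 3
  rw [hprod, mul_inv_cancel_right₀ hd, unitModulusChar_localRing_eq_prod L v u]

/-- **Vanishing off the `U(J)`-regular set**: a non-unit discriminant has a vanishing component, so `N(discr) = 0` and the `N = 2` closed form is `0`. [cite: Rogawski1990, §12.5 p. 184] -/
theorem dgFormulaTwo_eq_zero_of_not_isUnit_discr (g : (UnitaryGroup.cmDatum L 2 J).Local v)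
    (h : ¬ IsUnit ((g.val : GL (Fin 2) (UnitaryGroup.LocalRing L v)).val.charpoly.discr)) :
    ((NNReal.sqrt (NNReal.sqrt
        ((∏ w : PlacesOver L v, normAbs (w.1.adicCompletion L) (((g.val : GL (Fin 2) (UnitaryGroup.LocalRing L v)).val.charpoly.discr) w)) *
          (∏ w : PlacesOver L v, normAbs (w.1.adicCompletion L) (((g.val : GL (Fin 2) (UnitaryGroup.LocalRing L v)).val.det) w))⁻¹)) : ℝ≥0) : ℝ) = 0 := by
  obtain ⟨w, hw⟩ := exists_apply_eq_zero_of_not_isUnit L v h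
  rw [Finset.prod_eq_zero (Finset.mem_univ w) (by rw [hw, map_zero]), zero_mul, NNReal.sqrt_zero, NNReal.sqrt_zero, NNReal.coe_zero]

/-- **The `N = 2` HC antecedent is inhabited iff the discriminant is a unit** (`u := discr·det⁻¹`). [cite: HarishChandra1999AdmissibleDistributions, §17] [cite: Rogawski1990, §4.9 p. 54] -/
theorem exists_unit_rel_iff_isUnit_discr_two (g : (UnitaryGroup.cmDatum L 2 J).Local v) :
    (∃ u : (UnitaryGroup.LocalRing L v)ˣ, (u : UnitaryGroup.LocalRing L v) * ((g.val : GL (Fin 2) (UnitaryGroup.LocalRing L v)).val.det) ^ (2 - 1) =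
      ((g.val : GL (Fin 2) (UnitaryGroup.LocalRing L v)).val.charpoly).discr) ↔
      IsUnit ((g.val : GL (Fin 2) (UnitaryGroup.LocalRing L v)).val.charpoly.discr) := by
  have hdet : IsUnit ((g.val : GL (Fin 2) (UnitaryGroup.LocalRing L v)).val.det) := Matrix.isUnits_det_units _
  constructor
  · rintro ⟨u, hu⟩
    rw [← hu]
    exact u.isUnit.mul (hdet.pow _)
  · intro hdisc
    obtain ⟨d, hd⟩ := hdet
    obtain ⟨e, he⟩ := hdisc
    refine ⟨e * (d ^ (2 - 1))⁻¹, ?_⟩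
    rw [← hd, ← he, ← Units.val_pow_eq_pow_val, ← Units.val_mul, inv_mul_cancel_right]

/-- **«DG-FIELD★» AT `N = 2` — the ∃-FIELD `D` on `U(J)(L⁺_v)` for any `2 × 2` form `J`** (any finite place `v`): there is a MEASURABLE `DG₂ : U(J)(L⁺_v) → ℝ`, `0` wherever the
discriminant of the characteristic polynomial is a non-unit, and `= √√‖u‖` whenever `u·det(γ)^(2−1) = discr(charpoly γ)` (the weight of ★ `normalizedCharacter_locallyBounded` at `N = 2`);
witness: the `N = 2` closed form.  Consumer: the `H`-side field `DH := DG₂ ∘ Prod.fst` of (B) «H-FIELDS» (F0P2-p01 (g21)) on `H = U(Φ₂)(L⁺_v) × U(Φ₁)(L⁺_v)` and the `D_H`-bound hypotheses of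
★ S12a `F0P3cStCharTSDefHGlue` ∕ ★ S13a `F0P3cStCharTSU2OfUpDom` ∕ S13c. [cite: Rogawski1990, §4.9 pp. 54–55; §12.5 p. 184] [cite: HarishChandra1999AdmissibleDistributions, §17] -/
theorem exists_DG_field_two [MeasurableSpace ((UnitaryGroup.cmDatum L 2 J).Local v)] [BorelSpace ((UnitaryGroup.cmDatum L 2 J).Local v)] :
    ∃ DG₂ : (UnitaryGroup.cmDatum L 2 J).Local v → ℝ, Measurable DG₂ ∧
      (∀ γ : (UnitaryGroup.cmDatum L 2 J).Local v, ¬ IsUnit ((γ.val.val.charpoly).discr) → DG₂ γ = 0) ∧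
      ∀ (γ : (UnitaryGroup.cmDatum L 2 J).Local v) (u : (UnitaryGroup.LocalRing L v)ˣ),
        (u : UnitaryGroup.LocalRing L v) * (γ.val.val.det) ^ (2 - 1) = (γ.val.val.charpoly).discr →
          DG₂ γ = ((NNReal.sqrt (NNReal.sqrt (unitModulusChar (UnitaryGroup.LocalRing L v) u)) : ℝ≥0) : ℝ) :=
  ⟨fun g => ((NNReal.sqrt (NNReal.sqrt
        ((∏ w : PlacesOver L v, normAbs (w.1.adicCompletion L) (((g.val : GL (Fin 2) (UnitaryGroup.LocalRing L v)).val.charpoly.discr) w)) *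
          (∏ w : PlacesOver L v, normAbs (w.1.adicCompletion L) (((g.val : GL (Fin 2) (UnitaryGroup.LocalRing L v)).val.det) w))⁻¹)) : ℝ≥0) : ℝ),
    (continuous_dgFormulaTwo L v J).measurable,
    fun γ h => dgFormulaTwo_eq_zero_of_not_isUnit_discr L v J γ h,
    fun γ u hu => dgFormulaTwo_eq_of_unit_rel L v J γ u hu⟩

end Two

end Summit.HodgeConjecture.HodgeConjecture.Cruxes.H413.F0P3cStCharTSDGFieldTwo

end
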